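import Summits.RiemannHypothesis.RiemannHypothesis.Theorems.HandoffSemilocalParitySplit
import HarnessLib

/-!
# CONFINEMENT of low-energy test functions to the low block (third leg of the two-block picture)

Companion of `SemilocalDeletionCompression` (FLOOR: `Re Q_S(v + w) ≥ λ₋(m₁, m₂, β)‖v + w‖₂²`) and `SemilocalDeletionCompressionCeiling`
(two-level Ritz CEILING).  Here the CONFINEMENT leg: split a test function into two `L²`-orthogonal blocks `g = v + w` with

  `Re Q_S(v) ≥ m₁‖v‖₂²`,  `Re Q_S(w) ≥ m₂‖w‖₂²`,  `|Re C_S(v, w)| ≤ 2β‖v‖₂‖w‖₂`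

(`C_S` the cross form of `HandoffSemilocalParitySplit.weilSemilocalQuadratic_add`).  If `g` has LOW energy, `Re Q_S(g) ≤ E‖g‖₂²` with `E < m₂`
(the complement block is coercive ABOVE the energy of `g`), then the complement component is small:

* `sub_mul_integral_norm_sq_le` : `(m₂ − E)‖w‖₂² ≤ 2β‖v‖₂‖w‖₂ + (E − m₁)‖v‖₂²`;
* `integral_norm_sq_le_of_le_floor` : if moreover `E ≤ m₁` (e.g. `g` at or below the bottom of block `1` — every near-minimiser of a
  form whose compressed bottom is `m₁ = π ≥ λ_min`) then `‖w‖₂ ≤ (2β/(m₂ − E))·‖v‖₂`, i.e. the LEAKED MASS FRACTION is at most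
  `(2β/(m₂ − E))²/(1 + (2β/(m₂ − E))²)`.

Numerics of the `rh-explicit` cell (seat cc-s2-1 gen15, exploratory kit j223983 / j224368 on 104 certified deleted cells): with block `1` = the `2ν`
lowest directions of the window form, the deleted form's complement floor is `m₂ = 1.4…7.2` while the bottoms are `E = ε₁ ≈ −0.6…−2.0` and the coupling is
`β = 0.7…1.8`, so every deleted ground state carries at least `≈ 90 %` (b = 2) … `≈ 93 %` (b = 3) of its mass on the near-null directions BY THIS LEMMA
(measured: `≥ 99.8 %`; the two-level LEAK LAW `(r/κ)²` is the sharp value).  Statements about truncated Weil forms only; nothing here bears on RH.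
-/

set_option linter.dupNamespace false

noncomputable section

open Complex Filter Set MeasureTheory
open scoped Real Topology ComplexConjugate

namespace Summit.RiemannHypothesis.RiemannHypothesis.Theorems.SemilocalDeletionCompressionConfinement

open Literature.NumberTheory.LFunctions
open Summit.RiemannHypothesis.RiemannHypothesis.Theorems.HandoffSemilocalEnergy
open Summit.RiemannHypothesis.RiemannHypothesis.Theorems.HandoffSemilocalParitySplit

variable {S : Finset ℕ} {v w : ℝ → ℂ} {m₁ m₂ β E : ℝ}

/-- **CONFINEMENT INEQUALITY.**  `v ⊥ w` test functions, floors `m₁`, `m₂`, coupling `β`, and `Re Q_S(v + w) ≤ E·‖v + w‖₂²`: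
`(m₂ − E)‖w‖₂² ≤ 2β‖v‖₂‖w‖₂ + (E − m₁)‖v‖₂²`. -/
theorem sub_mul_integral_norm_sq_le (S : Finset ℕ) (hv : IsWeilTest v) (hw : IsWeilTest w) (horth : ∫ t, v t * conj (w t) = 0)
    (h₁ : m₁ * ∫ t, ‖v t‖ ^ 2 ≤ (weilSemilocalQuadratic S v).re) (h₂ : m₂ * ∫ t, ‖w t‖ ^ 2 ≤ (weilSemilocalQuadratic S w).re)
    (hC : |(weilSemilocalFunctional S (weilConv v (weilReflect w)) + weilSemilocalFunctional S (weilConv w (weilReflect v))).re| ≤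
      2 * β * Real.sqrt (∫ t, ‖v t‖ ^ 2) * Real.sqrt (∫ t, ‖w t‖ ^ 2))
    (hE : (weilSemilocalQuadratic S (v + w)).re ≤ E * ∫ t, ‖(v + w) t‖ ^ 2) :
    (m₂ - E) * ∫ t, ‖w t‖ ^ 2 ≤
      2 * β * Real.sqrt (∫ t, ‖v t‖ ^ 2) * Real.sqrt (∫ t, ‖w t‖ ^ 2) + (E - m₁) * ∫ t, ‖v t‖ ^ 2 := by
  -- polarisation of the form and of the norm (as in `SemilocalDeletionCompression` §2, inlined: that module has no hub olean yet)
  have hQ : (weilSemilocalQuadratic S (v + w)).re = (weilSemilocalQuadratic S v).re + (weilSemilocalQuadratic S w).re +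
      (weilSemilocalFunctional S (weilConv v (weilReflect w)) + weilSemilocalFunctional S (weilConv w (weilReflect v))).re := by
    have h := congrArg Complex.re (weilSemilocalQuadratic_add S hv hw)
    simpa only [Complex.add_re] using h
  have hN : ∫ t, ‖(v + w) t‖ ^ 2 = (∫ t, ‖v t‖ ^ 2) + ∫ t, ‖w t‖ ^ 2 := by
    have e : (fun t ↦ ‖(v + w) t‖ ^ 2) = fun t ↦ (‖v t‖ ^ 2 + ‖w t‖ ^ 2) + 2 * (v t * conj (w t)).re := by
      funext t
      rw [Pi.add_apply, ← Complex.normSq_eq_norm_sq, ← Complex.normSq_eq_norm_sq, ← Complex.normSq_eq_norm_sq, Complex.normSq_add]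
    have i1 := hv.integrable_norm_sq
    have i2 := hw.integrable_norm_sq
    have i3 : Integrable fun t ↦ v t * conj (w t) := hv.integrable_mul (Complex.continuous_conj.comp hw.1.continuous)
    have i12 : Integrable fun t ↦ ‖v t‖ ^ 2 + ‖w t‖ ^ 2 := i1.add i2
    have i3' : Integrable fun t ↦ 2 * (v t * conj (w t)).re := (i3.re).const_mul 2
    have i4 : ∫ t, (v t * conj (w t)).re = (∫ t, v t * conj (w t)).re := by
      have := integral_re i3
      simpa only [RCLike.re_to_complex] using this
    rw [e, integral_add i12 i3', integral_add i1 i2, integral_const_mul, i4, horth, Complex.zero_re, mul_zero, add_zero]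
  rw [hQ, hN] at hE
  have hcross := le_abs_self
    (weilSemilocalFunctional S (weilConv v (weilReflect w)) + weilSemilocalFunctional S (weilConv w (weilReflect v))).re
  have hneg := neg_abs_le
    (weilSemilocalFunctional S (weilConv v (weilReflect w)) + weilSemilocalFunctional S (weilConv w (weilReflect v))).re
  nlinarith [hE, h₁, h₂, hC, hneg]

/-- **CONFINEMENT below the block-`1` floor.**  If in addition `E ≤ m₁` and `E < m₂`, then `‖w‖₂ ≤ (2β/(m₂ − E))‖v‖₂`
(as an inequality of square roots of the `L²` masses). -/
theorem sqrt_integral_norm_sq_le (S : Finset ℕ) (hv : IsWeilTest v) (hw : IsWeilTest w) (horth : ∫ t, v t * conj (w t) = 0)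
    (hβ : 0 ≤ β) (hEm₁ : E ≤ m₁) (hEm₂ : E < m₂)
    (h₁ : m₁ * ∫ t, ‖v t‖ ^ 2 ≤ (weilSemilocalQuadratic S v).re) (h₂ : m₂ * ∫ t, ‖w t‖ ^ 2 ≤ (weilSemilocalQuadratic S w).re)
    (hC : |(weilSemilocalFunctional S (weilConv v (weilReflect w)) + weilSemilocalFunctional S (weilConv w (weilReflect v))).re| ≤
      2 * β * Real.sqrt (∫ t, ‖v t‖ ^ 2) * Real.sqrt (∫ t, ‖w t‖ ^ 2))
    (hE : (weilSemilocalQuadratic S (v + w)).re ≤ E * ∫ t, ‖(v + w) t‖ ^ 2) :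
    Real.sqrt (∫ t, ‖w t‖ ^ 2) ≤ 2 * β / (m₂ - E) * Real.sqrt (∫ t, ‖v t‖ ^ 2) := by
  have hmain := sub_mul_integral_norm_sq_le S hv hw horth h₁ h₂ hC hE
  have hA0 : 0 ≤ ∫ t, ‖v t‖ ^ 2 := integral_nonneg fun _ ↦ by positivity
  have hB0 : 0 ≤ ∫ t, ‖w t‖ ^ 2 := integral_nonneg fun _ ↦ by positivity
  obtain ⟨a, ha0, ha2⟩ : ∃ a : ℝ, 0 ≤ a ∧ a ^ 2 = ∫ t, ‖v t‖ ^ 2 := ⟨_, Real.sqrt_nonneg _, Real.sq_sqrt hA0⟩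
  obtain ⟨b, hb0, hb2⟩ : ∃ b : ℝ, 0 ≤ b ∧ b ^ 2 = ∫ t, ‖w t‖ ^ 2 := ⟨_, Real.sqrt_nonneg _, Real.sq_sqrt hB0⟩
  have hsa : Real.sqrt (∫ t, ‖v t‖ ^ 2) = a := by rw [← ha2, Real.sqrt_sq ha0]
  have hsb : Real.sqrt (∫ t, ‖w t‖ ^ 2) = b := by rw [← hb2, Real.sqrt_sq hb0]
  rw [hsa, hsb, ← ha2, ← hb2] at hmain
  rw [hsa, hsb]
  have hgap : 0 < m₂ - E := sub_pos.2 hEm₂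
  rw [div_mul_eq_mul_div, le_div_iff₀ hgap]
  -- from `(m₂ − E) b² ≤ 2β a b + (E − m₁) a²` and `E ≤ m₁`: `(m₂ − E) b² ≤ 2β a b`, divide by `b` (or `b = 0`)
  have hb2le : (m₂ - E) * b ^ 2 ≤ 2 * β * a * b := by nlinarith [hmain, sq_nonneg a, hEm₁]
  rcases hb0.eq_or_lt with hb00 | hbpos
  · rw [← hb00, zero_mul]; positivity
  · have h3 : (m₂ - E) * b * b ≤ 2 * β * a * b := by rw [sq] at hb2le; linarith
    have := le_of_mul_le_mul_right h3 hbpos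
    linarith

/-- **LEAKED MASS FRACTION.**  Under the hypotheses of `sqrt_integral_norm_sq_le`, with `θ := 2β/(m₂ − E)`:
`‖w‖₂² ≤ θ²·‖v‖₂²`, hence `‖w‖₂²/‖v + w‖₂² ≤ θ²/(1 + θ²)` — the mass of a low-energy function outside block `1` is at most `θ²/(1+θ²)`
of the total. -/
theorem integral_norm_sq_le_mul (S : Finset ℕ) (hv : IsWeilTest v) (hw : IsWeilTest w) (horth : ∫ t, v t * conj (w t) = 0)
    (hβ : 0 ≤ β) (hEm₁ : E ≤ m₁) (hEm₂ : E < m₂)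
    (h₁ : m₁ * ∫ t, ‖v t‖ ^ 2 ≤ (weilSemilocalQuadratic S v).re) (h₂ : m₂ * ∫ t, ‖w t‖ ^ 2 ≤ (weilSemilocalQuadratic S w).re)
    (hC : |(weilSemilocalFunctional S (weilConv v (weilReflect w)) + weilSemilocalFunctional S (weilConv w (weilReflect v))).re| ≤
      2 * β * Real.sqrt (∫ t, ‖v t‖ ^ 2) * Real.sqrt (∫ t, ‖w t‖ ^ 2))
    (hE : (weilSemilocalQuadratic S (v + w)).re ≤ E * ∫ t, ‖(v + w) t‖ ^ 2) :
    ∫ t, ‖w t‖ ^ 2 ≤ (2 * β / (m₂ - E)) ^ 2 * ∫ t, ‖v t‖ ^ 2 := by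
  have h := sqrt_integral_norm_sq_le S hv hw horth hβ hEm₁ hEm₂ h₁ h₂ hC hE
  have hA0 : 0 ≤ ∫ t, ‖v t‖ ^ 2 := integral_nonneg fun _ ↦ by positivity
  have hB0 : 0 ≤ ∫ t, ‖w t‖ ^ 2 := integral_nonneg fun _ ↦ by positivity
  have hθ : 0 ≤ 2 * β / (m₂ - E) := div_nonneg (by positivity) (sub_pos.2 hEm₂).le
  have h0 : 0 ≤ Real.sqrt (∫ t, ‖w t‖ ^ 2) := Real.sqrt_nonneg _
  have hsq := mul_self_le_mul_self h0 h
  rw [← sq, ← sq, Real.sq_sqrt hB0, mul_pow, Real.sq_sqrt hA0] at hsq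
  exact hsq

end Summit.RiemannHypothesis.RiemannHypothesis.Theorems.SemilocalDeletionCompressionConfinement
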